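import Summits.CriticalPhenomena.PercolationContinuityZ3.Theorems.PercNearOneGluingNoHeavyLowerTailAntitheticConeMixedShift
import HarnessLib

/-!
# `NoHeavyLowerTail` (stmt-CriticalPhenomena-4575) — antithetic cluster pairs: **CONJECTURE Δ2 AT `x` FROM THE MIXED SHIFTED SUM OF `G − x`
# ALONE** (the `a = b = 0` case of the shifted handle principle, packaged; prim-hp-2 gen 67, HOME/MEMO-gen67.md §2(b))

Support file (`--supports stmt-CriticalPhenomena-4575`, hull-port prover `prim-hp-2`, gen 67).  No definitions, no named facts, no sorries;
standard axioms.

THE REMARK (MEMO-gen67 §2(b)).  The shifted handle principle (…AntitheticHandlePrincipleShift) asks the (⊕_j)_shift hypotheses only along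
the `z`-stub (`j < b`); with BOTH arms of length `0` — `x` joined directly to `y` and `z` — the only hypothesis left is the mixed shifted sum
  (M)_shift(E₀; y, z): `0 ≤ Σ_{T : y ∈ X T, z ∉ Y T} (F⁺(X T) − F⁻(Y T))(G⁺(X T) − G⁻(Y T))` for all monotone `F⁻ ≤ F⁺`, `G⁻ ≤ G⁺`.
So for EVERY finite graph `G` and every degree-2 vertex `x` with non-adjacent neighbours `y, z`, CONJECTURE Δ2 at `x` (the vertex antithetic
inequality at `R = {x}`) follows from (M)_shift of `G − x` at `(y, z)` — or at `(z, y)`, by the symmetry of the statement.  This file states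
that reduction once, for direct use by certificate files ((M)_shift by the kernel decider …ShiftDecide, by separable certificates …SepDecide,
or structurally — THEOREM M1, …ConeMixedShift):
* `Antithetic.DegTwo.vertex_sum_nonneg_of_mixed_shift` — `E₀` loop-free, `x` on no pair of `E₀`, `x ∉ {s, y, z}`, `y ≠ z`, `yz ∉ E₀`,
  (M)_shift(E₀; y, z) ⇒ `0 ≤ Σ_{ω : ¬(x ∈ X_E ω ∧ x ∈ Y_E ω)} (F(X_E ω) − F(Y_E ω))(G(X_E ω) − G(Y_E ω))`, `E = E₀ + xy + xz`, all monotone `F, G`.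
* `Antithetic.DegTwo.vertex_sum_nonneg_of_mixed_shift'` — the same from (M)_shift(E₀; z, y) (edge set written `E₀ + xz + xy`).
CONJECTURE M-OR (HOME/MEMO-gen56 §0(5), alive): one of the two always holds; it implies CONJECTURE Δ2 for `yz ∉ E`.
[cite: VandenbergHaggstromKahn2005, §1 p. 6 ("Harris' inequality"), §1 p. 3 (open cluster `C_s`)]
-/

noncomputable section

namespace Summit.CriticalPhenomena.PercolationContinuityZ3.Theorems

open Literature.Probability.Percolation
open scoped Classical

namespace Antithetic

namespace DegTwo

variable {V : Type*} [Fintype V] {E₀ : Set (Sym2 V)} {s x y z : V}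
  (hnd : ∀ f ∈ E₀, ¬ f.IsDiag) (hx : ∀ f ∈ E₀, x ∈ f → f.IsDiag) (hxs : x ≠ s) (hxy : x ≠ y) (hxz : x ≠ z) (hyz : y ≠ z)
  (hg : s(y, z) ∉ E₀)
include hnd hx hxs hxy hxz hyz hg

/-- **CONJECTURE Δ2 at `x` from (M)_shift(G − x; y, z).**  `E₀` loop-free through `s`, `x` a fresh vertex joined to `y ≠ z` (`yz ∉ E₀`,
`x ≠ s`); if `0 ≤ Σ_{T : y ∈ X T, z ∉ Y T} (F⁺(X T) − F⁻(Y T))(G⁺(X T) − G⁻(Y T))` for all monotone nested pairs (clusters of `s` in `E₀`),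
then for all monotone `F, G`: `0 ≤ Σ_{ω : ¬(x ∈ X_E ω ∧ x ∈ Y_E ω)} (F(X_E ω) − F(Y_E ω))(G(X_E ω) − G(Y_E ω))`, `E = E₀ + xy + xz`.
[this work] -/
theorem vertex_sum_nonneg_of_mixed_shift
    (hmixed : ∀ Fp Fm Gp Gm : Set V → ℝ, Monotone Fp → Monotone Fm → (∀ S, Fm S ≤ Fp S) →
      Monotone Gp → Monotone Gm → (∀ S, Gm S ≤ Gp S) →
      0 ≤ ∑ T ∈ Finset.univ.filter (fun T : Set (Sym2 V) => y ∈ openCluster (T ∩ E₀) s ∧ z ∉ openCluster (Tᶜ ∩ E₀) s),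
        (Fp (openCluster (T ∩ E₀) s) - Fm (openCluster (Tᶜ ∩ E₀) s)) * (Gp (openCluster (T ∩ E₀) s) - Gm (openCluster (Tᶜ ∩ E₀) s)))
    {F G : Set V → ℝ} (hF : Monotone F) (hG : Monotone G) :
    0 ≤ ∑ ω ∈ Finset.univ.filter (fun ω : Set (Sym2 V) =>
        ¬ ((openGraph (ω ∩ insert s(x, y) (insert s(x, z) E₀))).Reachable s x ∧
          (openGraph (ωᶜ ∩ insert s(x, y) (insert s(x, z) E₀))).Reachable s x)),
      (F (openCluster (ω ∩ insert s(x, y) (insert s(x, z) E₀)) s) - F (openCluster (ωᶜ ∩ insert s(x, y) (insert s(x, z) E₀)) s)) *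
        (G (openCluster (ω ∩ insert s(x, y) (insert s(x, z) E₀)) s) - G (openCluster (ωᶜ ∩ insert s(x, y) (insert s(x, z) E₀)) s)) := by
  -- both arms of length `0`
  let u : ℕ → V := fun _ => y
  let w : ℕ → V := fun _ => z
  have hE : E₀ = (Cyc.edgeSet 0 u ∪ E₀) ∪ Cyc.edgeSet 0 w := by
    rw [TwoStage.Cone.edgeSet_zero, TwoStage.Cone.edgeSet_zero, Set.empty_union, Set.union_empty]
  have h := Pendant.handle_vertex_sum_nonneg_of_shift (E₀ := E₀) (s := s) (P := y) (Q := z) (u := u) (w := w) (a := 0) (b := 0)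
    rfl rfl (fun i hi hia => absurd hia (by omega)) (fun i hi hib => absurd hib (by omega)) (fun i j hi hj _ => by omega)
    (fun i j hi hj _ => by omega) (fun i hi hia => absurd hia (by omega)) (fun i hi hib => absurd hib (by omega))
    (fun i hi hib => absurd hib (by omega)) (fun i hi hia => absurd hia (by omega)) (fun j hj => absurd hj (Nat.not_lt_zero j)) hmixed hnd
    (x := x) (by rw [← hE]; exact hx) hxs hxy hxz hyz (by rw [← hE]; exact hg) hF hG
  rw [← hE] at h
  exact h

/-- **The same from the other orientation** (M)_shift(G − x; z, y): the conclusion for `E = E₀ + xz + xy` (the same set, written with the two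
new pairs in the other order). [this work] -/
theorem vertex_sum_nonneg_of_mixed_shift'
    (hmixed : ∀ Fp Fm Gp Gm : Set V → ℝ, Monotone Fp → Monotone Fm → (∀ S, Fm S ≤ Fp S) →
      Monotone Gp → Monotone Gm → (∀ S, Gm S ≤ Gp S) →
      0 ≤ ∑ T ∈ Finset.univ.filter (fun T : Set (Sym2 V) => z ∈ openCluster (T ∩ E₀) s ∧ y ∉ openCluster (Tᶜ ∩ E₀) s),
        (Fp (openCluster (T ∩ E₀) s) - Fm (openCluster (Tᶜ ∩ E₀) s)) * (Gp (openCluster (T ∩ E₀) s) - Gm (openCluster (Tᶜ ∩ E₀) s)))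
    {F G : Set V → ℝ} (hF : Monotone F) (hG : Monotone G) :
    0 ≤ ∑ ω ∈ Finset.univ.filter (fun ω : Set (Sym2 V) =>
        ¬ ((openGraph (ω ∩ insert s(x, z) (insert s(x, y) E₀))).Reachable s x ∧
          (openGraph (ωᶜ ∩ insert s(x, z) (insert s(x, y) E₀))).Reachable s x)),
      (F (openCluster (ω ∩ insert s(x, z) (insert s(x, y) E₀)) s) - F (openCluster (ωᶜ ∩ insert s(x, z) (insert s(x, y) E₀)) s)) *
        (G (openCluster (ω ∩ insert s(x, z) (insert s(x, y) E₀)) s) - G (openCluster (ωᶜ ∩ insert s(x, z) (insert s(x, y) E₀)) s)) :=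
  vertex_sum_nonneg_of_mixed_shift hnd hx hxs hxz hxy (Ne.symm hyz) (by rw [Sym2.eq_swap]; exact hg) hmixed hF hG

end DegTwo

end Antithetic

end Summit.CriticalPhenomena.PercolationContinuityZ3.Theorems
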